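import Mathlib
import Literature.AlgebraicGeometry.Resolution.ProperModelsExtension

/-!
# Crux `PatchingRel` (stmt-ResolutionOfSingularities-0642), line `sandwiched-gluing`,
# stub `stub_properExtension_of_nagata`

Nagata ⇒ extension of proper birational modifications over opens of PROPER models of a function
field: given Nagata's compactification theorem (NAMED FACT `NagataCompactification.{0}`,
received as a hypothesis), every proper birational `g : Y → U` from an integral scheme `Y` to an
open `U` of a proper model `P` of `K/k` extends to a morphism of proper models `φ : P' → P`
together with an open immersion `i : Y → P'.X` making `Y = P' ×_P U` a cartesian square
(`IsPullback i g φ.f U.ι`). This is the universe-`0` instance of the tree theorem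
`Literature.AlgebraicGeometry.Resolution.ProperModel.exists_extension_of_nagata`
(`ProperModelsExtension.lean`): compactify `Y → U ⊆ P` over `P` (Nagata), take the closure `Z`
of `Y`, "open + proper ⇒ clopen ⇒ everything" gives `Z ×_P U = Y`
(`Literature.AlgebraicGeometry.Morphisms.isPullback_of_isOpenImmersion_of_universallyClosed`),
and a proper modification of a proper model which is an isomorphism over a non-empty open is a
proper model (`ProperModel.ofModification`).
-/

noncomputable section

open CategoryTheory AlgebraicGeometry
open Literature.AlgebraicGeometry.Resolution Literature.AlgebraicGeometry.Morphisms

-- `Summit.<Summit>.<Sub>.Theorems` with `Sub = Summit` (single-conjunct summit, D-0017): the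
-- duplicated namespace component is the tree layout.
set_option linter.dupNamespace false

namespace Summit.ResolutionOfSingularities.ResolutionOfSingularities.Theorems

/-- **Stub `stub_properExtension_of_nagata` of line `sandwiched-gluing`** (crux `PatchingRel`,
stmt-ResolutionOfSingularities-0642): Nagata's compactification theorem implies that every
proper birational `g : Y → U` from an integral scheme `Y` to an open `U` of a proper model `P`
of `K/k` extends to a morphism of proper models `φ : P' → P` with an open immersion
`i : Y → P'.X` and `Y = P' ×_P U` (`IsPullback i g φ.f U.ι`): compactify `Y → P` (Nagata), pass
to the closure of `Y`, use "open + proper ⇒ clopen ⇒ everything" for the cartesian square, and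
`ProperModel.ofModification` for the model structure (`ProperModel.exists_extension_of_nagata`).
[cite: Piltant2013, proof of Prop. 5.1, Step 5] -/
theorem stub_properExtension_of_nagata : NagataCompactification.{0} →
    ∀ (k : Type) [Field k] (K : Type) [Field K] [Algebra k K] (P : ProperModel k K)
      (U : P.X.Opens) (Y : Scheme.{0}) [IsIntegral Y] (g : Y ⟶ (U : Scheme.{0})) [IsProper g],
      IsBirational g →
        ∃ (P' : ProperModel k K) (φ : P'.Hom P) (i : Y ⟶ P'.X), IsOpenImmersion i ∧
          IsPullback i g φ.f U.ι :=
  fun hN _ _ _ _ _ P U Y _ g _ hg => ProperModel.exists_extension_of_nagata hN P U Y g hg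

end Summit.ResolutionOfSingularities.ResolutionOfSingularities.Theorems

end
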